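import Mathlib.Tactic.Linarith
import Summits.CriticalPhenomena.PercolationContinuityZ3.Theorems.PercNearOneGluingNoHeavyLowerTailSahiCTCEdgeHarris
import Summits.CriticalPhenomena.PercolationContinuityZ3.Theorems.PercNearOneGluingNoHeavyLowerTailSahiCTCCubeCounts
import HarnessLib

/-!
# `NoHeavyLowerTail` (crux stmt-CriticalPhenomena-4575), P3 lane: product coefficients at a SINGLETON profile and the cross-term bound (L5)
# `E1 ≤ Cuv + Cvu + Π_G·D` for the single-common-edge case of the ladder form

Support file (seat `prim-l12-p3`, gen 24; `--supports stmt-CriticalPhenomena-4575`).  Memo `run/shared/lean/prim/prim-l12/FROM-prim-l12-p3-g24-VALUE-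
LEVEL-TH2K.md` §5.8 (Lean blueprint, lemma (L5)).  Notation of `…SahiCTCEdgeHarris` (sections `X0 ⊆ Xu, Xv` of an up-set at `u, v` over `G = univ∖{u,v}`,
cross Harris blocks `Cuv, Cvu`, cross defect `D`).
* `ind_add_ind_eq_ind_singleton`, `coeff_powerset_mul_gf_ind_singleton`, `coeff_gf_mul_gf_ind_singleton_eq_zero`;
* **`coeff_crossDefect_ge_singles`** : (L5) — at the profile `1_{x}` the right side is `1 + [x ∈ Yu] + [x ∈ Yv] ≥ 1`, elsewhere `E1` vanishes.
Nothing is asserted about the crux.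
-/

namespace Summit.CriticalPhenomena.PercolationContinuityZ3.Theorems.SahiCTCForms

open Finset MvPolynomial SahiCTCGenFun

variable {α : Type*} [DecidableEq α] [Fintype α]

/-! ### Product coefficients at a singleton profile -/

omit [Fintype α] in
/-- `1_P + 1_S = 1_{{x}}` forces `{P, S} = {∅, {x}}`. [this work] -/
theorem ind_add_ind_eq_ind_singleton {P S : Finset α} {x : α} (h : ind P + ind S = ind ({x} : Finset α)) :
    (P = ∅ ∧ S = {x}) ∨ (P = {x} ∧ S = ∅) := by
  obtain ⟨_, hI, hU⟩ := (ind_add_ind_eq_iff P S _).1 h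
  have hdbl : dbl (ind ({x} : Finset α)) = ∅ := by
    ext i; simp only [dbl, mem_filter, Finsupp.mem_support_iff, ind_apply, notMem_empty, iff_false]
    rintro ⟨_, h2⟩; split_ifs at h2; all_goals omega
  have hsupp : (ind ({x} : Finset α)).support = {x} := by
    ext i; simp only [Finsupp.mem_support_iff, ind_apply, mem_singleton]; split_ifs with h <;> simp_all
  rw [hdbl] at hI; rw [hsupp] at hU
  have hPsub : P ⊆ {x} := hU ▸ subset_union_left
  have hSsub : S ⊆ {x} := hU ▸ subset_union_right
  rcases subset_singleton_iff.1 hPsub with hP | hP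
  · left; refine ⟨hP, ?_⟩; rw [hP, empty_union] at hU; exact hU
  · right; refine ⟨hP, ?_⟩
    rcases subset_singleton_iff.1 hSsub with hS | hS
    · exact hS
    · exfalso; have : x ∈ P ∩ S := mem_inter.2 ⟨by rw [hP]; simp, by rw [hS]; simp⟩
      rw [hI] at this; exact notMem_empty x this

omit [Fintype α] in
/-- For a family `F ∌ ∅`: `coeff_{1_{{x}}} (GF(2^G)·GF(F)) = [{x} ∈ F]`. [this work] -/
theorem coeff_powerset_mul_gf_ind_singleton (G : Finset α) {F : Finset (Finset α)} (hF : ∅ ∉ F) (x : α) :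
    (gf G.powerset * gf F).coeff (ind ({x} : Finset α)) = if ({x} : Finset α) ∈ F then 1 else 0 := by
  rw [coeff_gf_mul_gf]
  split_ifs with hx
  · have : ((G.powerset ×ˢ F).filter fun PS => ind PS.1 + ind PS.2 = ind ({x} : Finset α)) = {(∅, {x})} := by
      ext PS; simp only [mem_filter, mem_product, mem_singleton]
      constructor
      · rintro ⟨⟨_, hS⟩, hsum⟩
        rcases ind_add_ind_eq_ind_singleton hsum with ⟨h1, h2⟩ | ⟨_, h2⟩
        · exact Prod.ext h1 h2
        · exact absurd (h2 ▸ hS) hF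
      · rintro rfl
        refine ⟨⟨mem_powerset.2 (empty_subset _), hx⟩, ?_⟩
        show ind ∅ + ind {x} = ind {x}
        unfold ind; rw [sum_empty, zero_add]
    rw [this, card_singleton]; rfl
  · have : ((G.powerset ×ˢ F).filter fun PS => ind PS.1 + ind PS.2 = ind ({x} : Finset α)) = ∅ := by
      refine filter_eq_empty_iff.2 fun PS hPS hsum => ?_
      obtain ⟨_, hS⟩ := mem_product.1 hPS
      rcases ind_add_ind_eq_ind_singleton hsum with ⟨_, h2⟩ | ⟨_, h2⟩
      · exact hx (h2 ▸ hS)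
      · exact hF (h2 ▸ hS)
    rw [this, card_empty]; rfl

omit [Fintype α] in
/-- For families `F, F' ∌ ∅`: `coeff_{1_{{x}}} (GF(F)·GF(F')) = 0`. [this work] -/
theorem coeff_gf_mul_gf_ind_singleton_eq_zero {F F' : Finset (Finset α)} (hF : ∅ ∉ F) (hF' : ∅ ∉ F') (x : α) :
    (gf F * gf F').coeff (ind ({x} : Finset α)) = 0 := by
  rw [coeff_gf_mul_gf]
  have : ((F ×ˢ F').filter fun PS => ind PS.1 + ind PS.2 = ind ({x} : Finset α)) = ∅ := by
    refine filter_eq_empty_iff.2 fun PS hPS hsum => ?_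
    obtain ⟨hP, hS⟩ := mem_product.1 hPS
    rcases ind_add_ind_eq_ind_singleton hsum with ⟨h1, _⟩ | ⟨_, h2⟩
    · exact hF (h1 ▸ hP)
    · exact hF' (h2 ▸ hS)
  rw [this, card_empty]; rfl

/-! ### (L5): the cross terms dominate the singletons -/

/-- **(L5)** For all-live up-sets `𝒳, 𝒵` whose only common 2-set is `{u,v}` — so no `{x}`, `x ∈ G = univ∖{u,v}`, lies in both `Xu` and `Zu` —
`GF{#S = 1 on G} ≤ Cuv + Cvu + Π_G·D` coefficientwise (notation of `…SahiCTCEdgeHarris`). [this work] -/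
theorem coeff_crossDefect_ge_singles {𝒳 𝒵 : Finset (Finset α)} (h𝒳 : IsUpperSet (𝒳 : Set (Finset α)))
    (h𝒵 : IsUpperSet (𝒵 : Set (Finset α))) (hl𝒳 : ∀ S ∈ 𝒳, 2 ≤ #S) (hl𝒵 : ∀ S ∈ 𝒵, 2 ≤ #S) {u v : α} {G : Finset α}
    (n : α →₀ ℕ) :
    (gf (G.powerset.filter fun S => #S = 1)).coeff n ≤
      ((gf G.powerset * gf ((G.powerset.filter fun S => insert u S ∈ 𝒳) ∩ (G.powerset.filter fun S => insert v S ∈ 𝒵))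
          - gf (G.powerset.filter fun S => insert u S ∈ 𝒳) * gf (G.powerset.filter fun S => insert v S ∈ 𝒵))
        + (gf G.powerset * gf ((G.powerset.filter fun S => insert v S ∈ 𝒳) ∩ (G.powerset.filter fun S => insert u S ∈ 𝒵))
          - gf (G.powerset.filter fun S => insert v S ∈ 𝒳) * gf (G.powerset.filter fun S => insert u S ∈ 𝒵))
        + gf G.powerset * (gf (((G.powerset \ ((G.powerset.filter fun S => S ∈ 𝒳) ∪ (G.powerset.filter fun S => S ∈ 𝒵))).erase ∅))
          + gf ((G.powerset.filter fun S => insert u S ∈ 𝒳) ∩ (G.powerset.filter fun S => insert u S ∈ 𝒵))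
          + gf ((G.powerset.filter fun S => insert v S ∈ 𝒳) ∩ (G.powerset.filter fun S => insert v S ∈ 𝒵))
          - gf ((G.powerset.filter fun S => insert u S ∈ 𝒳) ∩ (G.powerset.filter fun S => insert v S ∈ 𝒵))
          - gf ((G.powerset.filter fun S => insert v S ∈ 𝒳) ∩ (G.powerset.filter fun S => insert u S ∈ 𝒵)))).coeff n := by
  -- generic facts
  have sub_of : ∀ {p : Finset α → Prop} [DecidablePred p], ∀ T ∈ G.powerset.filter p, T ⊆ G :=
    fun T hT => mem_powerset.1 (mem_filter.1 hT).1
  have upw : ∀ {𝒲 : Finset (Finset α)} (w : α), IsUpperSet (𝒲 : Set (Finset α)) →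
      ∀ A ∈ G.powerset.filter (fun S => insert w S ∈ 𝒲), ∀ B : Finset α, A ⊆ B → B ⊆ G →
        B ∈ G.powerset.filter (fun S => insert w S ∈ 𝒲) := by
    intro 𝒲 w h𝒲 A hA B hAB hBG
    exact mem_filter.2 ⟨mem_powerset.2 hBG, h𝒲 (insert_subset_insert w hAB) (mem_filter.1 hA).2⟩
  have hsing : ∀ (𝒲 : Finset (Finset α)) (w : α), (∀ S ∈ 𝒲, 2 ≤ #S) → ({w} : Finset α) ∉ 𝒲 := fun 𝒲 w hl h => by
    have h2 := hl _ h; rw [card_singleton] at h2; omega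
  have hempu𝒳 : (∅ : Finset α) ∉ G.powerset.filter (fun S => insert u S ∈ 𝒳) := fun h =>
    hsing 𝒳 u hl𝒳 (by simpa using (mem_filter.1 h).2)
  have hempv𝒳 : (∅ : Finset α) ∉ G.powerset.filter (fun S => insert v S ∈ 𝒳) := fun h =>
    hsing 𝒳 v hl𝒳 (by simpa using (mem_filter.1 h).2)
  have hempu𝒵 : (∅ : Finset α) ∉ G.powerset.filter (fun S => insert u S ∈ 𝒵) := fun h =>
    hsing 𝒵 u hl𝒵 (by simpa using (mem_filter.1 h).2)
  have hempv𝒵 : (∅ : Finset α) ∉ G.powerset.filter (fun S => insert v S ∈ 𝒵) := fun h =>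
    hsing 𝒵 v hl𝒵 (by simpa using (mem_filter.1 h).2)
  have hempI : ∀ {A B : Finset (Finset α)}, (∅ : Finset α) ∉ A → (∅ : Finset α) ∉ A ∩ B := fun h h' => h (mem_inter.1 h').1
  have hempN : (∅ : Finset α) ∉ ((G.powerset \ ((G.powerset.filter fun S => S ∈ 𝒳) ∪ (G.powerset.filter fun S => S ∈ 𝒵))).erase ∅) :=
    notMem_erase _ _
  -- nonnegativity of the whole right side
  have nC1 := coeff_harris_upIn_sub_nonneg (G := G) sub_of sub_of (upw u h𝒳) (upw v h𝒵)
  have nC2 := coeff_harris_upIn_sub_nonneg (G := G) sub_of sub_of (upw v h𝒳) (upw u h𝒵)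
  have nD := coeff_crossDefect_nonneg h𝒳 h𝒵 hl𝒳 (u := u) (v := v) G
  have nPD : ∀ m, 0 ≤ (gf G.powerset * (gf (((G.powerset \ ((G.powerset.filter fun S => S ∈ 𝒳) ∪ (G.powerset.filter fun S => S ∈ 𝒵))).erase ∅))
          + gf ((G.powerset.filter fun S => insert u S ∈ 𝒳) ∩ (G.powerset.filter fun S => insert u S ∈ 𝒵))
          + gf ((G.powerset.filter fun S => insert v S ∈ 𝒳) ∩ (G.powerset.filter fun S => insert v S ∈ 𝒵))
          - gf ((G.powerset.filter fun S => insert u S ∈ 𝒳) ∩ (G.powerset.filter fun S => insert v S ∈ 𝒵))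
          - gf ((G.powerset.filter fun S => insert v S ∈ 𝒳) ∩ (G.powerset.filter fun S => insert u S ∈ 𝒵)))).coeff m :=
    coeff_mul_nonneg (coeff_gf_nonneg _) nD
  by_cases hx : ∃ x ∈ G, ind ({x} : Finset α) = n
  · obtain ⟨x, hxG, rfl⟩ := hx
    have hxF1 : ({x} : Finset α) ∈ G.powerset.filter (fun S => #S = 1) :=
      mem_filter.2 ⟨mem_powerset.2 (singleton_subset_iff.2 hxG), card_singleton x⟩
    rw [coeff_gf_of_mem hxF1]
    -- evaluate every term at the profile 1_{x}
    simp only [coeff_add, coeff_sub, mul_add, mul_sub]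
    have nYu : (∅ : Finset α) ∉ (G.powerset.filter fun S => insert u S ∈ 𝒳) ∩ (G.powerset.filter fun S => insert u S ∈ 𝒵) := hempI hempu𝒳
    have nYv : (∅ : Finset α) ∉ (G.powerset.filter fun S => insert v S ∈ 𝒳) ∩ (G.powerset.filter fun S => insert v S ∈ 𝒵) := hempI hempv𝒳
    have nIuv : (∅ : Finset α) ∉ (G.powerset.filter fun S => insert u S ∈ 𝒳) ∩ (G.powerset.filter fun S => insert v S ∈ 𝒵) := hempI hempu𝒳
    have nIvu : (∅ : Finset α) ∉ (G.powerset.filter fun S => insert v S ∈ 𝒳) ∩ (G.powerset.filter fun S => insert u S ∈ 𝒵) := hempI hempv𝒳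
    simp only [coeff_powerset_mul_gf_ind_singleton G nYu x, coeff_powerset_mul_gf_ind_singleton G nYv x,
      coeff_powerset_mul_gf_ind_singleton G nIuv x, coeff_powerset_mul_gf_ind_singleton G nIvu x,
      coeff_powerset_mul_gf_ind_singleton G hempN x,
      coeff_gf_mul_gf_ind_singleton_eq_zero hempu𝒳 hempv𝒵 x, coeff_gf_mul_gf_ind_singleton_eq_zero hempv𝒳 hempu𝒵 x]
    -- {x} is in neither 𝒳 nor 𝒵 and is not ∅
    have hxN : ({x} : Finset α) ∈ ((G.powerset \ ((G.powerset.filter fun S => S ∈ 𝒳) ∪ (G.powerset.filter fun S => S ∈ 𝒵))).erase ∅) := by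
      refine mem_erase.2 ⟨singleton_ne_empty x, mem_sdiff.2 ⟨mem_powerset.2 (singleton_subset_iff.2 hxG), ?_⟩⟩
      rw [mem_union]; rintro (h | h)
      · exact hsing 𝒳 x hl𝒳 (mem_filter.1 h).2
      · exact hsing 𝒵 x hl𝒵 (mem_filter.1 h).2
    simp only [hxN, if_true, mem_inter]
    by_cases a1 : ({x} : Finset α) ∈ G.powerset.filter (fun S => insert u S ∈ 𝒳) <;>
      by_cases a2 : ({x} : Finset α) ∈ G.powerset.filter (fun S => insert v S ∈ 𝒵) <;>
      by_cases a3 : ({x} : Finset α) ∈ G.powerset.filter (fun S => insert v S ∈ 𝒳) <;>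
      by_cases a4 : ({x} : Finset α) ∈ G.powerset.filter (fun S => insert u S ∈ 𝒵) <;>
      simp [a1, a2, a3, a4]
  · have h0 : (gf (G.powerset.filter fun S => #S = 1)).coeff n = 0 := by
      refine coeff_gf_eq_zero_of_forall fun T hT hTn => hx ?_
      obtain ⟨hTG, hT1⟩ := mem_filter.1 hT
      obtain ⟨x, rfl⟩ := card_eq_one.1 hT1
      exact ⟨x, mem_powerset.1 hTG (mem_singleton_self x), hTn⟩
    rw [h0, coeff_add, coeff_add]
    exact add_nonneg (add_nonneg (nC1 n) (nC2 n)) (nPD n)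

end Summit.CriticalPhenomena.PercolationContinuityZ3.Theorems.SahiCTCForms
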